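import Literature.Topology.FourManifolds.GradientLikeDynamics
import HarnessLib

/-!
# Levels along the orbits of a flow whose speed lies in `[0, 1]`

Topic `Literature/Topology/FourManifolds` (fact seat
`provefact-Literature.Topology.FourManifolds.IsHandlebody.exists_isBoundaryGluing_sphere`, step F2b of
the Lickorish–Wallace DAG; flow layer of the handle-extension step of the classification of
handlebodies).  Everything here is **proved**; no named facts.

Milnor, *Lectures on the h-cobordism theorem* (1965), proof of Thm. 3.4 (PDF p. 13):
`d/dt f(φ(t)) = ξ(f)`.  For the field of the handle-extension step the speed `X(f)` equals `1`
on a slab `f⁻¹[ℓ₁, ℓ₂]` except in the core of the handle chart, where it lies in `[0, 1]`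
(`HandleModelField.lean`); so along a forward orbit the level does not decrease and rises at
most at unit rate, as long as it stays in the slab:

* `IsFlowOf.apply_mem_Icc_of_speed_mem` — if `X(f) ∈ [0, 1]` on `f⁻¹[ℓ₁, ℓ₂]`, `ℓ₁ < f z` and
  `f z + T < ℓ₂`, then `f z ≤ f (θ (t, z)) ≤ f z + t` for `0 ≤ t ≤ T`;
* `IsFlowOf.apply_neg_mem_Icc_of_speed_mem` — the backward twin `f z - t ≤ f (θ (-t, z)) ≤ f z`.

Both by real induction on `t` (`IsClosed.Icc_subset_of_forall_mem_nhdsGT_of_Icc_subset`) and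
the sign of the derivative near the frontier time.

## References

* J. Milnor, *Lectures on the h-cobordism theorem* (1965), proof of Thm. 3.4 (PDF p. 13).
  [MilnorHCobordism1965]
-/

open scoped Manifold ContDiff Topology
open Set Function Filter Metric

noncomputable section

namespace Literature.Topology.FourManifolds

variable {E : Type*} [NormedAddCommGroup E] [NormedSpace ℝ E] {H : Type*} [TopologicalSpace H]
  {I : ModelWithCorners ℝ E H} {M : Type*} [TopologicalSpace M] [ChartedSpace H M]
  {f : M → ℝ} {X : Π x : M, TangentSpace I x} {θ : ℝ × M → M}

/-- Real induction for a level estimate along a curve: if `P t := (lo t ≤ g t ∧ g t ≤ hi t)` holds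
at `0`, all of `g, lo, hi` are continuous, and whenever `P` holds on `[0, t₀]` (`t₀ < T`) it holds
on some `[t₀, t₀ + δ)`, then it holds on `[0, T]`. [folklore] -/
theorem Icc_subset_of_levels {g lo hi : ℝ → ℝ} (hg : Continuous g) (hlo : Continuous lo)
    (hhi : Continuous hi) {T : ℝ} (h0 : lo 0 ≤ g 0 ∧ g 0 ≤ hi 0)
    (hstep : ∀ t₀ ∈ Ico 0 T, (∀ t ∈ Icc 0 t₀, lo t ≤ g t ∧ g t ≤ hi t) →
      ∀ᶠ t in 𝓝[>] t₀, lo t ≤ g t ∧ g t ≤ hi t) :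
    ∀ t ∈ Icc 0 T, lo t ≤ g t ∧ g t ≤ hi t := by
  set S : Set ℝ := {t | lo t ≤ g t ∧ g t ≤ hi t} with hS
  have hSc : IsClosed S := (isClosed_le hlo hg).inter (isClosed_le hg hhi)
  have hsub : Icc 0 T ⊆ S :=
    (hSc.inter isClosed_Icc).Icc_subset_of_forall_mem_nhdsGT_of_Icc_subset h0
      fun t₀ ht₀ hseg => hstep t₀ ht₀ fun t ht => hseg ht
  exact fun t ht => hsub ht

/-- **Levels along a forward orbit when the speed lies in `[0, 1]` on a slab**: if
`0 ≤ X(f) ≤ 1` on `f⁻¹[ℓ₁, ℓ₂]`, `ℓ₁ < f z` and `f z + T < ℓ₂`, then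
`f z ≤ f (θ (t, z)) ≤ f z + t` for all `t ∈ [0, T]` (Milnor's `df/dt = ξ(f)`, integrated).
[cite: MilnorHCobordism1965, proof of Thm. 3.4 (PDF p. 13)] -/
theorem IsFlowOf.apply_mem_Icc_of_speed_mem (h : IsFlowOf I X θ) (hf : ContMDiff I 𝓘(ℝ, ℝ) ∞ f)
    {ℓ₁ ℓ₂ : ℝ} (hspeed : ∀ x, f x ∈ Icc ℓ₁ ℓ₂ → mlineDeriv I f x (X x) ∈ Icc (0 : ℝ) 1)
    {z : M} (hz : ℓ₁ < f z) {T : ℝ} (hT : f z + T < ℓ₂) {t : ℝ} (ht : t ∈ Icc 0 T) :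
    f z ≤ f (θ (t, z)) ∧ f (θ (t, z)) ≤ f z + t := by
  set g : ℝ → ℝ := fun t => f (θ (t, z)) with hg
  have hgc : Continuous g := hf.continuous.comp (h.continuous_orbit z)
  have hderiv : ∀ t, HasDerivAt g (mlineDeriv I f (θ (t, z)) (X (θ (t, z)))) t :=
    fun t => h.hasDerivAt_apply hf z t
  have hmain := Icc_subset_of_levels (g := g) (lo := fun _ => f z) (hi := fun t => f z + t) hgc
    continuous_const (continuous_const.add continuous_id) (T := T)
    (by simp [hg, h.map_zero]) ?_
  · exact hmain t ht
  intro t₀ ht₀ hseg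
  -- near `t₀` the level is in the open slab, so the speed is in `[0, 1]`
  have hlev₀ := hseg t₀ (right_mem_Icc.2 ht₀.1)
  have hopen : IsOpen {s : ℝ | g s ∈ Ioo ℓ₁ ℓ₂} := isOpen_Ioo.preimage hgc
  have hmem₀ : t₀ ∈ {s : ℝ | g s ∈ Ioo ℓ₁ ℓ₂} := by
    refine ⟨lt_of_lt_of_le hz hlev₀.1, lt_of_le_of_lt hlev₀.2 ?_⟩
    show f z + t₀ < ℓ₂
    linarith [ht₀.2]
  obtain ⟨δ, hδ, hball⟩ := Metric.isOpen_iff.1 hopen t₀ hmem₀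
  have hsp : ∀ s ∈ Icc t₀ (t₀ + δ / 2), mlineDeriv I f (θ (s, z)) (X (θ (s, z))) ∈ Icc (0 : ℝ) 1 := by
    intro s hs
    have hs' : s ∈ ball t₀ δ := by
      rw [mem_ball, Real.dist_eq, abs_lt]; constructor <;> linarith [hs.1, hs.2]
    have := hball hs'
    exact hspeed _ ⟨this.1.le, this.2.le⟩
  -- monotonicity of `g` and of `g - id` on `[t₀, t₀ + δ/2]`
  have hconv : Convex ℝ (Icc t₀ (t₀ + δ / 2)) := convex_Icc _ _
  have hdiff : DifferentiableOn ℝ g (interior (Icc t₀ (t₀ + δ / 2))) :=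
    fun s _ => (hderiv s).differentiableAt.differentiableWithinAt
  have hmono : MonotoneOn g (Icc t₀ (t₀ + δ / 2)) :=
    monotoneOn_of_deriv_nonneg hconv hgc.continuousOn hdiff fun s hs => by
      rw [(hderiv s).deriv]
      exact (hsp s (interior_subset hs)).1
  have hanti : AntitoneOn (fun s => g s - s) (Icc t₀ (t₀ + δ / 2)) :=
    antitoneOn_of_deriv_nonpos hconv (hgc.sub continuous_id).continuousOn
      (fun s _ => ((hderiv s).fun_sub (hasDerivAt_id' s)).differentiableAt.differentiableWithinAt)
      fun s hs => by
        rw [((hderiv s).fun_sub (hasDerivAt_id' s)).deriv]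
        linarith [(hsp s (interior_subset hs)).2]
  have hev : ∀ᶠ s in 𝓝[>] t₀, s ∈ Icc t₀ (t₀ + δ / 2) :=
    mem_nhdsWithin.2 ⟨Iio (t₀ + δ / 2), isOpen_Iio, by show t₀ < t₀ + δ / 2; linarith,
      fun s hs => ⟨le_of_lt hs.2, le_of_lt hs.1⟩⟩
  filter_upwards [hev] with s hs
  have h1 := hmono (left_mem_Icc.2 (by linarith)) hs hs.1
  have h2 := hanti (left_mem_Icc.2 (by linarith)) hs hs.1
  simp only at h2
  exact ⟨hlev₀.1.trans h1, by linarith [hlev₀.2]⟩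

/-- **Levels along a backward orbit when the speed lies in `[0, 1]` on a slab**: if
`0 ≤ X(f) ≤ 1` on `f⁻¹[ℓ₁, ℓ₂]`, `f z < ℓ₂` and `ℓ₁ < f z - T`, then
`f z - t ≤ f (θ (-t, z)) ≤ f z` for all `t ∈ [0, T]`. [cite: MilnorHCobordism1965, proof of Thm. 3.4 (PDF p. 13)] -/
theorem IsFlowOf.apply_neg_mem_Icc_of_speed_mem (h : IsFlowOf I X θ) (hf : ContMDiff I 𝓘(ℝ, ℝ) ∞ f)
    {ℓ₁ ℓ₂ : ℝ} (hspeed : ∀ x, f x ∈ Icc ℓ₁ ℓ₂ → mlineDeriv I f x (X x) ∈ Icc (0 : ℝ) 1)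
    {z : M} (hz : f z < ℓ₂) {T : ℝ} (hT : ℓ₁ < f z - T) {t : ℝ} (ht : t ∈ Icc 0 T) :
    f z - t ≤ f (θ (-t, z)) ∧ f (θ (-t, z)) ≤ f z := by
  set g : ℝ → ℝ := fun t => f (θ (-t, z)) with hg
  have hgc : Continuous g := hf.continuous.comp ((h.continuous_orbit z).comp continuous_neg)
  have hderiv : ∀ t, HasDerivAt g (-mlineDeriv I f (θ (-t, z)) (X (θ (-t, z)))) t := by
    intro t
    have h1 := h.hasDerivAt_apply hf z (-t)
    have h2 : HasDerivAt g ((-1 : ℝ) • mlineDeriv I f (θ (-t, z)) (X (θ (-t, z)))) t :=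
      h1.scomp t (hasDerivAt_neg t)
    rwa [neg_one_smul] at h2
  have hmain := Icc_subset_of_levels (g := g) (lo := fun t => f z - t) (hi := fun _ => f z) hgc
    (continuous_const.sub continuous_id) continuous_const (T := T)
    (by simp [hg, h.map_zero]) ?_
  · exact hmain t ht
  intro t₀ ht₀ hseg
  have hlev₀ := hseg t₀ (right_mem_Icc.2 ht₀.1)
  have hopen : IsOpen {s : ℝ | g s ∈ Ioo ℓ₁ ℓ₂} := isOpen_Ioo.preimage hgc
  have hmem₀ : t₀ ∈ {s : ℝ | g s ∈ Ioo ℓ₁ ℓ₂} := by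
    refine ⟨lt_of_lt_of_le ?_ hlev₀.1, lt_of_le_of_lt hlev₀.2 hz⟩
    show ℓ₁ < f z - t₀
    linarith [ht₀.2]
  obtain ⟨δ, hδ, hball⟩ := Metric.isOpen_iff.1 hopen t₀ hmem₀
  have hsp : ∀ s ∈ Icc t₀ (t₀ + δ / 2), mlineDeriv I f (θ (-s, z)) (X (θ (-s, z))) ∈ Icc (0 : ℝ) 1 := by
    intro s hs
    have hs' : s ∈ ball t₀ δ := by
      rw [mem_ball, Real.dist_eq, abs_lt]; constructor <;> linarith [hs.1, hs.2]
    have := hball hs'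
    exact hspeed _ ⟨this.1.le, this.2.le⟩
  have hconv : Convex ℝ (Icc t₀ (t₀ + δ / 2)) := convex_Icc _ _
  have hanti : AntitoneOn g (Icc t₀ (t₀ + δ / 2)) :=
    antitoneOn_of_deriv_nonpos hconv hgc.continuousOn
      (fun s _ => (hderiv s).differentiableAt.differentiableWithinAt) fun s hs => by
        rw [(hderiv s).deriv]
        linarith [(hsp s (interior_subset hs)).1]
  have hmono : MonotoneOn (fun s => g s + s) (Icc t₀ (t₀ + δ / 2)) :=
    monotoneOn_of_deriv_nonneg hconv (hgc.add continuous_id).continuousOn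
      (fun s _ => ((hderiv s).fun_add (hasDerivAt_id' s)).differentiableAt.differentiableWithinAt)
      fun s hs => by
        rw [((hderiv s).fun_add (hasDerivAt_id' s)).deriv]
        linarith [(hsp s (interior_subset hs)).2]
  have hev : ∀ᶠ s in 𝓝[>] t₀, s ∈ Icc t₀ (t₀ + δ / 2) :=
    mem_nhdsWithin.2 ⟨Iio (t₀ + δ / 2), isOpen_Iio, by show t₀ < t₀ + δ / 2; linarith,
      fun s hs => ⟨le_of_lt hs.2, le_of_lt hs.1⟩⟩
  filter_upwards [hev] with s hs
  have h1 := hanti (left_mem_Icc.2 (by linarith)) hs hs.1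
  have h2 := hmono (left_mem_Icc.2 (by linarith)) hs hs.1
  simp only at h2
  exact ⟨by linarith [hlev₀.1], h1.trans hlev₀.2⟩

end Literature.Topology.FourManifolds
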